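import Summits.CriticalPhenomena.CardyFormulaZ2.Theorems.CardyComplexConeParafermionToSLESixFamiliesDiamondDefsR5
import Summits.CriticalPhenomena.CardyFormulaZ2.Theorems.CardyComplexConeParafermionToSLESixFamiliesDiamondExactPotentialTracePh3
import Summits.CriticalPhenomena.CardyFormulaZ2.Theorems.CardyComplexConeParafermionToSLESixFamiliesDiamondArcsConnected
import Summits.CriticalPhenomena.CardyFormulaZ2.Theorems.CardyComplexConeParafermionToSLESixFamiliesDiamondTouchLowerFrames
import HarnessLib

/-!
# The lattice box of a diamond discretisation read in all four side frames at once, and the bridge from open paths to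
# the touch event (line `potential-darboux-picard-diamond`, S3 (c) `freeTouchLower_of_diagArmLower`, part 5)

Crux `ParafermionToSLESixFamilies` (stmt-CriticalPhenomena-11389), line `potential-darboux-picard-diamond`, conditional
helper `freeTouchLower_of_diagArmLower` of S3. The landed side charts (`exists_sideChart`: frame
`e′ₖ = exp(-iπ/4)·sideFrame k`, across coordinate `(δ/√2)·layerFn (k+2) + X₀ k`, along coordinate
`(δ/√2)·layerFn (k+3) + Y₀ k`, last inside layer `n k`) are here taken for the FOUR sides simultaneously
(`exists_fourCharts`); the four frames are related by quarter turns (`re_frame_succ`, `re_frame_add_two`,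
`re_frame_add_three`), so that:

* `mem_carrier_iff_forall_layerFn_le` — a lattice point lies in the open diamond iff `layerFn (k+2) ≤ n k` for all `k`
  (the box of `diamondArcs_exists_box`, with the depths of the charts), and `layerFn_le_iff` reads single layers;
* `depth_bounds` — `2·sideHalfWidth − 2h ≤ h·(n k + n (k+2)) < 2·sideHalfWidth`, `h = δ/√2` (the box is as wide as the
  diamond);
* `boxFacts` — for an admissible datum on the diamond read at this mesh: the discrete boundary is the two-layer frame
  `{∃ k, n k − 1 ≤ layerFn (k+2)}` of the box (`diamondArcs_zdBoundary_iff_frame`) and `Ω_δ`-adjacency inside the box is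
  lattice adjacency; in particular the interior `boxI n` (`…TouchLowerLattice`: all depths `nrm n k ≥ 0`) misses both arcs;
* `layerFn_siteOf` — lattice sites with prescribed chart coordinates (local notation `site[j, A, B]`);
* `touchEvent_of_openConnIn` — an `ω`-open lattice path inside a region of the box avoiding the dual-wired arc `B`, ending
  on the wired arc `A`, is open in the completed configuration `bcBondConfig ω`: the touch event `{x ↔ A}` holds.
-/

noncomputable section

namespace Summit.CriticalPhenomena.CardyFormulaZ2.Cruxes.ParafermionToSLESixFamilies.PotentialDarbouxPicardDiamond

open scoped Topology
open Filter Set Metric Complex MeasureTheory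
open Literature.Probability Literature.Probability.LatticeModels Literature.Probability.Percolation
open Literature.Probability.LatticeModels.DiscreteDobrushin
open Literature.Probability.RandomPlanarGeometry
open Summit.CriticalPhenomena.CardyFormulaZ2.Cruxes.ParafermionToSLESixFamilies.IicTraceFluxPairing

/-! ## The four frames -/

/-- The frames of consecutive sides differ by a quarter turn: the across coordinate of side `k + 1` is the along
coordinate of side `k`. -/
theorem re_frame_succ (w e : ℂ) (k : Fin 4) : (w * (e * sideFrame (k + 1))).re = (w * (e * sideFrame k)).im := by
  fin_cases k <;> simp [sideFrame, ← mul_assoc]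

/-- Opposite sides have opposite across coordinates. -/
theorem re_frame_add_two (w e : ℂ) (k : Fin 4) : (w * (e * sideFrame (k + 2))).re = -(w * (e * sideFrame k)).re := by
  fin_cases k <;> simp [sideFrame, ← mul_assoc]

/-- The across coordinate of side `k + 3` is minus the along coordinate of side `k`. -/
theorem re_frame_add_three (w e : ℂ) (k : Fin 4) : (w * (e * sideFrame (k + 3))).re = -(w * (e * sideFrame k)).im := by
  fin_cases k <;> simp [sideFrame, ← mul_assoc]

/-- The half-widths: `sideHalfWidth (k+1) = sideHalfLength k`, `sideHalfWidth (k+2) = sideHalfWidth k`,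
`sideHalfWidth (k+3) = sideHalfLength k`. -/
theorem sideHalfWidth_shifts (α β : ℝ) (k : Fin 4) : sideHalfWidth α β (k + 1) = sideHalfLength α β k ∧
    sideHalfWidth α β (k + 2) = sideHalfWidth α β k ∧ sideHalfWidth α β (k + 3) = sideHalfLength α β k := by
  fin_cases k <;> simp [sideHalfWidth, sideHalfLength]

/-- **The four side charts at once.** For every mesh `δ > 0`: frames `e′ k`, offsets `X₀ k, Y₀ k` and last inside layers
`n k` for all four sides, with the chart facts of `exists_sideChart`. -/
theorem exists_fourCharts (c : ℂ) (α β : ℝ) {δ : ℝ} (hδ : 0 < δ) : ∃ (X₀ Y₀ : Fin 4 → ℝ) (n : Fin 4 → ℤ), ∀ k : Fin 4,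
    ‖exp (-(Real.pi / 4 : ℝ) * I) * sideFrame k‖ = 1 ∧
    {z : ℂ | |((z - c) * exp (-(Real.pi / 4 : ℝ) * I)).re| < α ∧ |((z - c) * exp (-(Real.pi / 4 : ℝ) * I)).im| < β} =
      {z : ℂ | |((z - c) * (exp (-(Real.pi / 4 : ℝ) * I) * sideFrame k)).re| < sideHalfWidth α β k ∧
        |((z - c) * (exp (-(Real.pi / 4 : ℝ) * I) * sideFrame k)).im| < sideHalfLength α β k} ∧
    (∀ x : Site 2, ((meshPoint δ x - c) * (exp (-(Real.pi / 4 : ℝ) * I) * sideFrame k)).re =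
      Real.sqrt 2 / 2 * δ * layerFn (k + 2) x + X₀ k) ∧
    (∀ x : Site 2, ((meshPoint δ x - c) * (exp (-(Real.pi / 4 : ℝ) * I) * sideFrame k)).im =
      Real.sqrt 2 / 2 * δ * layerFn (k + 2 + 1) x + Y₀ k) ∧
    Real.sqrt 2 / 2 * δ * n k + X₀ k < sideHalfWidth α β k ∧ sideHalfWidth α β k ≤ Real.sqrt 2 / 2 * δ * (n k + 1) + X₀ k := by
  have h := fun k => exists_sideChart c α β k hδ
  choose e' X₀ Y₀ n he' hnorm hbox hX hY hn hn' using h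
  refine ⟨X₀, Y₀, n, fun k => ?_⟩
  have e := he' k
  refine ⟨?_, ?_, ?_, ?_, ?_, ?_⟩
  · rw [← e]; exact hnorm k
  · rw [← e]; exact hbox k
  · rw [← e]; exact hX k
  · rw [← e]; exact hY k
  · exact hn k
  · exact hn' k

/-! ## The box -/

section Box

variable {c : ℂ} {α β δ : ℝ} (hδ : 0 < δ) {X₀ Y₀ : Fin 4 → ℝ} {n : Fin 4 → ℤ}
  (hch : ∀ k : Fin 4,
    ‖exp (-(Real.pi / 4 : ℝ) * I) * sideFrame k‖ = 1 ∧
    {z : ℂ | |((z - c) * exp (-(Real.pi / 4 : ℝ) * I)).re| < α ∧ |((z - c) * exp (-(Real.pi / 4 : ℝ) * I)).im| < β} =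
      {z : ℂ | |((z - c) * (exp (-(Real.pi / 4 : ℝ) * I) * sideFrame k)).re| < sideHalfWidth α β k ∧
        |((z - c) * (exp (-(Real.pi / 4 : ℝ) * I) * sideFrame k)).im| < sideHalfLength α β k} ∧
    (∀ x : Site 2, ((meshPoint δ x - c) * (exp (-(Real.pi / 4 : ℝ) * I) * sideFrame k)).re =
      Real.sqrt 2 / 2 * δ * layerFn (k + 2) x + X₀ k) ∧
    (∀ x : Site 2, ((meshPoint δ x - c) * (exp (-(Real.pi / 4 : ℝ) * I) * sideFrame k)).im =
      Real.sqrt 2 / 2 * δ * layerFn (k + 2 + 1) x + Y₀ k) ∧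
    Real.sqrt 2 / 2 * δ * n k + X₀ k < sideHalfWidth α β k ∧ sideHalfWidth α β k ≤ Real.sqrt 2 / 2 * δ * (n k + 1) + X₀ k)

include hδ hch in
/-- **Single layers**: the across coordinate of layer `L` of side `k` is inside iff `L ≤ n k`. -/
theorem layerFn_le_iff (k : Fin 4) (L : ℤ) : Real.sqrt 2 / 2 * δ * L + X₀ k < sideHalfWidth α β k ↔ L ≤ n k := by
  obtain ⟨-, -, -, -, hn, hn'⟩ := hch k
  have hpos : 0 < Real.sqrt 2 / 2 * δ := by positivity
  constructor
  · intro h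
    by_contra hlt
    have : (n k : ℝ) + 1 ≤ L := by exact_mod_cast (show n k + 1 ≤ L by omega)
    have := mul_le_mul_of_nonneg_left this hpos.le
    linarith
  · intro h
    have : (L : ℝ) ≤ n k := by exact_mod_cast h
    have := mul_le_mul_of_nonneg_left this hpos.le
    linarith

include hδ hch in
/-- **The lattice points of the diamond form the box `{∀ k, layerFn (k+2) ≤ n k}`.** -/
theorem mem_carrier_iff_forall_layerFn_le (x : Site 2) :
    meshPoint δ x ∈ {z : ℂ | |((z - c) * exp (-(Real.pi / 4 : ℝ) * I)).re| < α ∧ |((z - c) * exp (-(Real.pi / 4 : ℝ) * I)).im| < β} ↔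
      ∀ k, layerFn (k + 2) x ≤ n k := by
  set e := exp (-(Real.pi / 4 : ℝ) * I) with he
  have key : ∀ k, ((meshPoint δ x - c) * (e * sideFrame k)).re < sideHalfWidth α β k ↔ layerFn (k + 2) x ≤ n k := by
    intro k
    obtain ⟨-, -, hX, -⟩ := hch k
    rw [hX x]
    exact layerFn_le_iff hδ hch k _
  have s1 : e * sideFrame 1 = e := by simp [sideFrame]
  -- the four across coordinates in terms of the standard frame `e = e′₁`
  have r1 : ((meshPoint δ x - c) * (e * sideFrame 1)).re = ((meshPoint δ x - c) * e).re := by rw [s1]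
  have r2 : ((meshPoint δ x - c) * (e * sideFrame 2)).re = ((meshPoint δ x - c) * e).im := by
    rw [show (2 : Fin 4) = 1 + 1 by decide, re_frame_succ, s1]
  have r3 : ((meshPoint δ x - c) * (e * sideFrame 3)).re = -((meshPoint δ x - c) * e).re := by
    rw [show (3 : Fin 4) = 1 + 2 by decide, re_frame_add_two, s1]
  have r0 : ((meshPoint δ x - c) * (e * sideFrame 0)).re = -((meshPoint δ x - c) * e).im := by
    rw [show (0 : Fin 4) = 1 + 3 by decide, re_frame_add_three, s1]
  have w0 : sideHalfWidth α β 0 = β := by simp [sideHalfWidth]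
  have w1 : sideHalfWidth α β 1 = α := by simp [sideHalfWidth]
  have w2 : sideHalfWidth α β 2 = β := by simp [sideHalfWidth]
  have w3 : sideHalfWidth α β 3 = α := by simp [sideHalfWidth]
  have k0 := key 0; have k1 := key 1; have k2 := key 2; have k3 := key 3
  rw [r0, w0] at k0; rw [r1, w1] at k1; rw [r2, w2] at k2; rw [r3, w3] at k3
  simp only [mem_setOf_eq, abs_lt]
  constructor
  · rintro ⟨⟨h1, h2⟩, h3, h4⟩ k
    fin_cases k
    · exact k0.1 (by linarith)
    · exact k1.1 h2
    · exact k2.1 h4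
    · exact k3.1 (by linarith)
  · intro h
    have a0 := k0.2 (h 0); have a1 := k1.2 (h 1); have a2 := k2.2 (h 2); have a3 := k3.2 (h 3)
    exact ⟨⟨by linarith, a1⟩, by linarith, a2⟩

include hch in
/-- **The box is as wide as the diamond**: `2·sideHalfWidth − 2h ≤ h·(n k + n (k+2)) < 2·sideHalfWidth`, `h = δ/√2`. -/
theorem depth_bounds (k : Fin 4) :
    2 * sideHalfWidth α β k - 2 * (Real.sqrt 2 / 2 * δ) ≤ Real.sqrt 2 / 2 * δ * (n k + n (k + 2)) ∧
      Real.sqrt 2 / 2 * δ * (n k + n (k + 2)) < 2 * sideHalfWidth α β k := by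
  obtain ⟨-, -, hX, -, hn, hn'⟩ := hch k
  obtain ⟨-, -, hX2, -, hn2, hn2'⟩ := hch (k + 2)
  have hw : sideHalfWidth α β (k + 2) = sideHalfWidth α β k := (sideHalfWidth_shifts α β k).2.1
  -- `X₀ (k+2) = −X₀ k`
  have hX0 : X₀ (k + 2) = -X₀ k := by
    have h1 := hX 0
    have h2 := hX2 0
    rw [re_frame_add_two, h1, fin4_add_two_add_two'] at h2
    have h3 : layerFn (k + 2) (0 : Site 2) = 0 := by fin_cases k <;> simp [layerFn]
    have h4 : layerFn k (0 : Site 2) = 0 := by fin_cases k <;> simp [layerFn]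
    rw [h3, h4] at h2
    simp at h2
    linarith
  rw [hw, hX0] at hn2 hn2'
  constructor
  · have := add_le_add hn' hn2'; nlinarith
  · have := add_lt_add hn hn2; nlinarith

end Box

/-! ## The discrete boundary, adjacency, and the bridge to the touch event -/

section Facts

variable {D : DobrushinDomain} {c : ℂ} {α β : ℝ}
  (hcar : D.carrier = {z : ℂ | |((z - c) * exp (-(Real.pi / 4 : ℝ) * I)).re| < α ∧ |((z - c) * exp (-(Real.pi / 4 : ℝ) * I)).im| < β})
  {δ : ℝ} (hδ : 0 < δ) {E : DiscreteDobrushin} (hΩ : E.Ω = D.carrier) (hEδ : E.δ = δ)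
  (hgood : ∀ x : Site 2, meshPoint δ x ∈ D.carrier → x ∈ meshDomain D.carrier δ) {X₀ Y₀ : Fin 4 → ℝ} {n : Fin 4 → ℤ}
  (hch : ∀ k : Fin 4,
    ‖exp (-(Real.pi / 4 : ℝ) * I) * sideFrame k‖ = 1 ∧
    {z : ℂ | |((z - c) * exp (-(Real.pi / 4 : ℝ) * I)).re| < α ∧ |((z - c) * exp (-(Real.pi / 4 : ℝ) * I)).im| < β} =
      {z : ℂ | |((z - c) * (exp (-(Real.pi / 4 : ℝ) * I) * sideFrame k)).re| < sideHalfWidth α β k ∧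
        |((z - c) * (exp (-(Real.pi / 4 : ℝ) * I) * sideFrame k)).im| < sideHalfLength α β k} ∧
    (∀ x : Site 2, ((meshPoint δ x - c) * (exp (-(Real.pi / 4 : ℝ) * I) * sideFrame k)).re =
      Real.sqrt 2 / 2 * δ * layerFn (k + 2) x + X₀ k) ∧
    (∀ x : Site 2, ((meshPoint δ x - c) * (exp (-(Real.pi / 4 : ℝ) * I) * sideFrame k)).im =
      Real.sqrt 2 / 2 * δ * layerFn (k + 2 + 1) x + Y₀ k) ∧
    Real.sqrt 2 / 2 * δ * n k + X₀ k < sideHalfWidth α β k ∧ sideHalfWidth α β k ≤ Real.sqrt 2 / 2 * δ * (n k + 1) + X₀ k)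
  (h6 : 6 ≤ n 1 + n 3)

include hcar hδ hch in
/-- The box in the coordinates `s = x₀ + x₁`, `d = x₁ − x₀` of `…DiamondArcsFrame`. -/
theorem mem_carrier_iff_sd (x : Site 2) :
    meshPoint δ x ∈ D.carrier ↔ (-n 3 ≤ x 0 + x 1 ∧ x 0 + x 1 ≤ n 1 ∧ -n 0 ≤ x 1 - x 0 ∧ x 1 - x 0 ≤ n 2) := by
  rw [hcar, mem_carrier_iff_forall_layerFn_le hδ hch x]
  constructor
  · intro h
    have h0 := h 0; have h1 := h 1; have h2 := h 2; have h3 := h 3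
    simp [layerFn] at h0 h1 h2 h3
    omega
  · intro h k
    fin_cases k <;> simp [layerFn] <;> omega

include hcar hδ hΩ hEδ hgood hch h6 in
/-- **The discrete boundary is the two-layer frame of the box.** -/
theorem mem_zdBoundary_iff_exists (x : Site 2) :
    x ∈ E.zdBoundary ↔ (∀ k, layerFn (k + 2) x ≤ n k) ∧ ∃ k, n k - 1 ≤ layerFn (k + 2) x := by
  have hconv : Convex ℝ D.carrier := by rw [hcar]; exact convex_tiltedBox c _ α β
  rw [diamondArcs_zdBoundary_iff_frame D.carrier hconv δ hgood E hΩ hEδ (-n 3) (n 1) (-n 0) (n 2)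
    (mem_carrier_iff_sd hcar hδ hch) (by omega) x, ← mem_carrier_iff_sd hcar hδ hch x, hcar,
    mem_carrier_iff_forall_layerFn_le hδ hch x]
  refine and_congr Iff.rfl ⟨fun h => ?_, fun ⟨k, hk⟩ => ?_⟩
  · rcases h with h | h | h | h
    · exact ⟨3, by simp [layerFn]; omega⟩
    · exact ⟨1, by simp [layerFn]; omega⟩
    · exact ⟨0, by simp [layerFn]; omega⟩
    · exact ⟨2, by simp [layerFn]; omega⟩
  · fin_cases k <;> simp [layerFn] at hk <;> omega

include hcar hδ hΩ hEδ hgood hch in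
/-- **Inside the box, `Ω_δ`-adjacency is lattice adjacency.** -/
theorem adj_iff_of_forall {x y : Site 2} (hx : ∀ k, layerFn (k + 2) x ≤ n k) (hy : ∀ k, layerFn (k + 2) y ≤ n k) :
    (discreteDomainGraph E.Ω E.δ).Adj x y ↔ (zdGraph 2).Adj x y := by
  have hconv : Convex ℝ D.carrier := by rw [hcar]; exact convex_tiltedBox c _ α β
  rw [hΩ, hEδ]
  exact ArcsConn.adj_iff_of_mem_box hconv hgood (mem_carrier_iff_sd hcar hδ hch) ((mem_carrier_iff_sd hcar hδ hch x).1
    (by rw [hcar, mem_carrier_iff_forall_layerFn_le hδ hch]; exact hx)) ((mem_carrier_iff_sd hcar hδ hch y).1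
    (by rw [hcar, mem_carrier_iff_forall_layerFn_le hδ hch]; exact hy))

include hcar hδ hΩ hEδ hgood hch h6 in
/-- Sites of depth `≥ 2` on every side are off the discrete boundary, hence off both arcs. -/
theorem not_mem_arcs_of_interior {x : Site 2} (hx : ∀ k, layerFn (k + 2) x ≤ n k - 2) :
    x ∉ E.zdBoundary ∧ x ∉ E.zdArcA ∧ x ∉ E.zdArcB := by
  have hb : x ∉ E.zdBoundary := fun h => by
    obtain ⟨-, k, hk⟩ := (mem_zdBoundary_iff_exists hcar hδ hΩ hEδ hgood hch h6 x).1 h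
    have := hx k; omega
  exact ⟨hb, fun h => hb (E.zdArcA_subset_zdBoundary h), fun h => hb (E.zdArcB_subset_zdBoundary h)⟩

include hcar hδ hΩ hEδ hgood hch in
/-- **The bridge to the touch event.** An `ω`-open path of lattice edges inside a region `R` of the box avoiding the
dual-wired arc, from `x` to a site `y` of the wired arc, is open in the completed configuration `bcBondConfig ω` (every
edge of it is an edge of `Ω_δ` with no endpoint on `B`): the touch event `{x ↔ A}` holds at `ω`. -/
theorem touchEvent_of_openConnIn {ω : BondConfig (Site 2)} (hω : ω ⊆ (zdGraph 2).edgeSet) {R : Set (Site 2)}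
    (hRbox : ∀ v ∈ R, ∀ k, layerFn (k + 2) v ≤ n k) (hRB : ∀ v ∈ R, v ∉ E.zdArcB) {x y : Site 2} (hyA : y ∈ E.zdArcA)
    (h : ω ∈ openConnIn R x y) : ∃ y ∈ E.zdArcA, (openGraph (E.bcBondConfig ω)).Reachable x y := by
  obtain ⟨hx, hy, hr⟩ := h
  let φ : (openGraph ω).induce R →g openGraph (E.bcBondConfig ω) :=
    { toFun := fun v => v.1
      map_rel' := by
        intro a b hab
        rw [SimpleGraph.induce_adj, openGraph_adj] at hab
        obtain ⟨hmem, hne⟩ := hab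
        have hadj : (zdGraph 2).Adj a.1 b.1 := (SimpleGraph.mem_edgeSet _).1 (hω hmem)
        have hadjΩ : (discreteDomainGraph E.Ω E.δ).Adj a.1 b.1 :=
          (adj_iff_of_forall hcar hδ hΩ hEδ hgood hch (hRbox _ a.2) (hRbox _ b.2)).2 hadj
        rw [openGraph_adj]
        refine ⟨⟨(SimpleGraph.mem_edgeSet _).2 hadjΩ, Or.inr ⟨hmem, fun z hz => ?_⟩⟩, hne⟩
        rcases Sym2.mem_iff.1 hz with rfl | rfl
        · exact hRB _ a.2
        · exact hRB _ b.2 }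
  exact ⟨y, hyA, hr.map φ⟩

include hδ hch in
/-- **Room along the side, upper end**: a lattice site whose along coordinate of side `k` is below `sideHalfLength` has
`layerFn (k+3) ≤ n (k+1)` (the frame of side `k + 1` reads the along coordinate of side `k` as its across coordinate). -/
theorem layerFn_add_three_le_of_im_lt (k : Fin 4) (y : Site 2)
    (hy : ((meshPoint δ y - c) * (exp (-(Real.pi / 4 : ℝ) * I) * sideFrame k)).im < sideHalfLength α β k) :
    layerFn (k + 3) y ≤ n (k + 1) := by
  obtain ⟨-, -, hX1, -⟩ := hch (k + 1)
  have h1 := hX1 y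
  rw [re_frame_succ, fin4_add_one_add_two] at h1
  rw [← fin4_add_one_add_two]
  refine (layerFn_le_iff hδ hch (k + 1) _).1 ?_
  rw [fin4_add_one_add_two, ← h1, (sideHalfWidth_shifts α β k).1]
  exact hy

include hδ hch in
/-- **Room along the side, lower end**: a lattice site whose along coordinate of side `k` is above `−sideHalfLength` has
`−layerFn (k+3) ≤ n (k+3)`. -/
theorem neg_layerFn_add_three_le_of_lt_im (k : Fin 4) (y : Site 2)
    (hy : -sideHalfLength α β k < ((meshPoint δ y - c) * (exp (-(Real.pi / 4 : ℝ) * I) * sideFrame k)).im) :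
    -layerFn (k + 3) y ≤ n (k + 3) := by
  obtain ⟨-, -, hX3, -⟩ := hch (k + 3)
  have h3 := hX3 y
  rw [re_frame_add_three, DiscreteDobrushin.fin4_three_two] at h3
  have e : layerFn (k + 1) y = -layerFn (k + 3) y := by
    rw [← fin4_add_one_add_two, layerFn_add_two]; ring
  rw [← e, ← DiscreteDobrushin.fin4_three_two]
  refine (layerFn_le_iff hδ hch (k + 3) _).1 ?_
  rw [DiscreteDobrushin.fin4_three_two, ← h3, (sideHalfWidth_shifts α β k).2.2]
  linarith

end Facts

/-! ## Lattice sites with prescribed chart coordinates -/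

/-- The lattice site with chart coordinates `(A, B)` of orientation `j` (meaningful for `A ≡ B (mod 2)`). -/
local notation3 "site[" j ", " A ", " B "]" => (((A : ℤ) - B) / 2) • cornerUnit (j + 1) + ((A + B) / 2) • cornerUnit (j + 2)

/-- **The chart coordinates of `site[j, A, B]`.** -/
theorem layerFn_siteOf (j : Fin 4) {A B : ℤ} (h : 2 ∣ A - B) :
    layerFn j site[j, A, B] = A ∧ layerFn (j + 1) site[j, A, B] = B := by
  obtain ⟨t, ht⟩ := h
  have c1 := layerFn_cornerUnit j 1
  have c2 := layerFn_cornerUnit j 2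
  have d1 := layerFn_succ_cornerUnit j 1
  have d2 := layerFn_succ_cornerUnit j 2
  simp only [Matrix.cons_val_one, Matrix.cons_val_zero, Matrix.cons_val] at c1 c2 d1 d2
  rw [layerFn_add, layerFn_add, layerFn_zsmul, layerFn_zsmul, layerFn_zsmul, layerFn_zsmul, c1, c2, d1, d2]
  constructor <;> omega

/-- **Registered form (helper of `freeTouchLower_of_diagArmLower`): the four side frames differ by quarter turns.** -/
theorem touchLower_re_frame : ∀ (w e : ℂ) (k : Fin 4), (w * (e * sideFrame (k + 1))).re = (w * (e * sideFrame k)).im ∧ (w * (e * sideFrame (k + 2))).re = -(w * (e * sideFrame k)).re ∧ (w * (e * sideFrame (k + 3))).re = -(w * (e * sideFrame k)).im :=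
  fun w e k => ⟨re_frame_succ w e k, re_frame_add_two w e k, re_frame_add_three w e k⟩

end Summit.CriticalPhenomena.CardyFormulaZ2.Cruxes.ParafermionToSLESixFamilies.PotentialDarbouxPicardDiamond

end
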